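import Summits.BirchSwinnertonDyer.Rank1Residual.Additive.PotMultRatMainConjLowerBoundOdd
import Summits.BirchSwinnertonDyer.Rank1Residual.Additive.GordChiBranchKatoComponent
import Summits.BirchSwinnertonDyer.Rank1Residual.Additive.SemistableTwistTowerThree
import Summits.BirchSwinnertonDyer.Rank1Residual.AdditivePotMult.PotMultChiBranchPrime
import Summits.BirchSwinnertonDyer.Rank1Residual.AdditivePotMult.CyclotomicThreeOfHalf
import Summits.BirchSwinnertonDyer.Rank1Residual.GaloisImage.JWitnessTowerSurjectivity
import Literature.NumberTheory.EllipticCurves.PAdicBSDSkinnerUrbanProofs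
import Literature.NumberTheory.EllipticCurves.CyclotomicIwasawaMainTheoremIrreducibleBaseChangeProofs
import Literature.NumberTheory.EllipticCurves.Wuthrich2014.ThreeAdicImageSupersingularProofs
import HarnessLib

/-!
# The located gap of T-N10R on the (M) locus in its NATIVE `Λ ⊗ ℚ_p` shape: the one-sided RATIONAL
# Skinner-type containment `char_Λ X ⊆ (L_p⁻(f♭, a_p, ω^{(p−1)/2}))` for the MULTIPLICATIVE twist, ODD
# branch — typed; Kato's printed half upgrades it to `ChiBranchRatCharEqMultOddAt`; (M)@3 ends
# (cell `b2b-bsdres`, team n1011, seat n1011-p06 gen 2, OWNERS row T-N10R, phase 4, (M) twin)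

HONEST FRAMING (cell `b2b-bsdres`, run/shared/lean/b2b/bsd-rank1-residual/, verbatim in every
file): the goal of the cell is to DELETE the COMBINATION-SHAPED residual classes of the
Birch–Swinnerton-Dyer formula for ALL analytic-rank `≤ 1` elliptic curves over `ℚ` — "full BSD
formula for every rank `≤ 1` curve in class `C`" assembled STRICTLY from published theorems — so
that the rank-`≤ 1` remainder becomes exactly the CONSTRUCTION-SHAPED classes, which are TYPED
(missing-input `Prop`s), NOT attempted. This is not "finishing BSD". Team n1011 (X4 ∧ `p = 3` / the
additive block, §I items N10 / N11): research routes; prove what is provable now; no claim beyond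
the stated classes; X4(M) stays CONSTRUCTION-SHAPED; labels / census / located gap UNCHANGED; nothing
is booked. ONE definition (a typed input, nothing asserted) and theorems; no new named fact (the
Literature inputs are the explicit binders `hKato` = the Kato/Wuthrich half-eigenspace reading,
`hDelX`, `hDel`).

## What and why

(M) twin of `ChiBranchRatLowerDvdOdd.lean` (same seat). On the (M) locus (`E` additive at `p`,
potentially multiplicative: `E = E♭ ⊗ χ_{−p}` with `E♭` MULTIPLICATIVE at `p`, `p ≡ 3 (mod 4)`, `p = 3`
included — the largest population of N10 / N11: 82 103 rank-`0` cells at `p = 3` of record) row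
T-N10R's typed input is the rational EQUALITY `ChiBranchRatCharEqMultOddAt W p`
(`PotMultRatMainConjLowerBoundOdd.lean`, p251062), on the ODD branch of the ONE-term measure
`padicLFunctionMinusBranchMult f♭ a_p ((p−1)/2)` (`a_p = ±1`). ONE containment is IN PRINT: the
semistable big-image half-eigenspace reading `Wuthrich2014.kato_halfEigenCharIdeal_dvd_cyclotomicPrime_of_surjective`
(Kato 2004 Thm. 17.4 (3) / Wuthrich 2014 Thm. 3, Cor. 19; its MULTIPLICATIVE disjuncts), transported
to `X(W/ℚ_∞)` by additive-p1's core (`SelmerDualData.isTorsion_and_exists_constantCoeff_of_halfTail`,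
which exported only the `T = 0` shadow — §1 re-runs it keeping the full series). The OTHER containment,
`char_Λ X ⊆ (ϖ⁻ L_p⁻) · (Λ ⊗ ℚ_p)`, is the located gap in the native currency of a Skinner-type
theorem (C. Skinner, Pacific J. Math. 283 (2016), multiplicative reduction — printed for the trivial
branch only; SU 2014 Cor. 3.6.2 shape). So:

* §0 TYPED: `ChiBranchRatLowerDvdMultOddAt W p`; nothing asserted; weaker than `ChiBranchRatCharEqMultOddAt`.
* §1 KERNEL: the half-tail core keeping the series (`isTorsion_and_exists_map_eq_of_halfTail`) and
  Kato's half on `X(W/ℚ_∞)`: `ι g₁ = u · ϖ⁻ · L_p⁻(f♭, a_p, ω^{(p−1)/2}, T)`.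
* §2 KERNEL (the split): §1 + §0 + the tower of `W` ⟹ `ChiBranchRatCharEqMultOddAt W p`.
* §3 ENDS on X4(M) ∧ surj(p) (tower from surj(p) with NO certificate: n1011-p14's
  `ClassX4M.towerSurj_of_surj`, every odd `p`): `ChiBranchRatLowerDvdMultOddAt W p` + ONE unit
  coefficient (`MultOddBranchUnitCoeffCert`) ⟹ (p251062) the LOWER half and `BSD(E,p)` at every
  `p ≡ 3 (mod 4)` and, TOWER-FREE, at `p = 3` (`hKato3 := kato_minusEigenCharIdeal_dvd_cyclotomicThree_of_surjective_of_half hKato`).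

X4(M) stays CONSTRUCTION-SHAPED; located gap unchanged in substance; nothing booked; no label change.

References: Skinner–Urban, Invent. Math. 195 (2014) Cor. 3.6.2, Thm. 3.6.4 [SkinnerUrban2014];
Kato, Astérisque 295 (2004) Thm. 17.4 (3) [Kato2004Asterisque]; Wuthrich, J. London Math. Soc. 90
(2014) Thm. 3, Cor. 19, Lemma 20 [Wuthrich2014]; Mazur–Tate–Teitelbaum, Invent. Math. 84 (1986)
§I.10–I.14 [MazurTateTeitelbaum1986Invent]; Greenberg, LNM 1716 §5 [GreenbergLNM1716]; Delbourgo,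
Compositio Math. 113 (1998) Prop. 4 [Delbourgo1998]; Miller, LMS JCM 14 (2011) Def. 1.1 [Miller2011LMS].
-/

noncomputable section

open scoped Classical MatrixGroups ModularForm NumberField

open CongruenceSubgroup WeierstrassCurve NumberField Literature.NumberTheory.EllipticCurves
  Literature.NumberTheory.EllipticCurves.ModularForms
  Literature.NumberTheory.EllipticCurves.Rank1Residual
  Literature.NumberTheory.EllipticCurves.Rank1Residual.Typed
  Literature.NumberTheory.GaloisRepresentations
  IsDedekindDomain

namespace Summit.BirchSwinnertonDyer.Rank1Residual.Additive

open AdditivePotMult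

/-! ### §0 The typed input: the one-sided RATIONAL containment on the odd branch, multiplicative twist -/

/-- **The Skinner direction of the `ω^{(p−1)/2}`-branch (ODD) cyclotomic main conjecture of the
MULTIPLICATIVE twist, RATIONALLY, TYPED** (`p ≡ 3 (mod 4)`, `p = 3` included). For the additive curve
`E = W` (globally minimal): whenever `W = C • V^{(−p)}` for a globally minimal `V = E♭` multiplicative
at `p` with newform `f` and `a_p(f) = ap` (`= ±1`), `κ`/`γ` the cyclotomic `ℤ_p`-extension with a
generator matching the cyclotomic variable, `D` a `Λ`-dual datum of `Sel_{p^∞}(W/ℚ_∞)` and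
`ϖ · |Ω⁻(V)| = Ω⁻_f`, EVERY `g ∈ char_Λ X(W/ℚ_∞)` has `p^m · g ∈ (G)` for some `G ∈ Λ`, `m n ∈ ℕ`, with
`ι G = p^n · ϖ · L_p⁻(f, ap, ω^{(p−1)/2}, T)` (the odd branch of the ONE-term measure,
`padicLFunctionMinusBranchMult`, MTT §I.10/§I.13) — `char_Λ X ⊆ (ϖ L_p⁻)·(Λ ⊗ ℚ_p)`, the SHAPE of
Skinner–Urban 2014 Cor. 3.6.2 / Skinner 2016 Thm. A on the `χ_{−p}`-branch (printed for the trivial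
branch only). OPEN — OUR typed missing input (`@[conjecture]`); nothing asserted.
[cite: SkinnerUrban2014, Cor. 3.6.2 (p. 42) (shape only; nothing asserted)]
[cite: MazurTateTeitelbaum1986Invent, §I.10, §I.13 (shape only; nothing asserted)] -/
@[conjecture] def ChiBranchRatLowerDvdMultOddAt (W : WeierstrassCurve ℚ) (p : ℕ) [Fact p.Prime] : Prop :=
  ∀ (V : WeierstrassCurve ℚ) [V.IsElliptic] [V.IsGloballyMinimal]
    {κ : ZpExtension ℚ p} {γ : Field.absoluteGaloisGroup ℚ} {N : ℕ} [NeZero N]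
    {f : CuspForm (Gamma0 N) 2},
    p % 4 = 3 →
    (∃ C : VariableChange ℚ, C • V.quadraticTwist (-(p : ℚ)) = W) →
    Mult V p →
    κ.IsCyclotomic → κ.IsTopGenerator γ → IsCyclotomicVariable p γ → IsNewformOf V f →
    ∀ (ap : ℤ), cuspCoeff f p = ap →
    ∀ (D : W.SelmerDualData κ γ) (ϖ : ℚ), (ϖ : ℝ) * V.imaginaryPeriodRat = minusPeriod f →
      ∀ g ∈ D.charIdeal, ∃ (G : IwasawaAlgebra p) (m n : ℕ),
        PowerSeries.C ((p : ℤ_[p]) ^ m) * g ∈ Ideal.span {G} ∧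
        iwasawaToPowerSeries p G =
          PowerSeries.C ((p : ℚ_[p]) ^ n) *
            (PowerSeries.C (ϖ : ℚ_[p]) * padicLFunctionMinusBranchMult f (ap : ℚ_[p]) (p / 2))

/-- Unfolding lemma for `ChiBranchRatLowerDvdMultOddAt` (to apply the predicate as a function). -/
theorem chiBranchRatLowerDvdMultOddAt_iff (W : WeierstrassCurve ℚ) (p : ℕ) [Fact p.Prime] :
    ChiBranchRatLowerDvdMultOddAt W p ↔
      ∀ (V : WeierstrassCurve ℚ) [V.IsElliptic] [V.IsGloballyMinimal]
        {κ : ZpExtension ℚ p} {γ : Field.absoluteGaloisGroup ℚ} {N : ℕ} [NeZero N]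
        {f : CuspForm (Gamma0 N) 2},
        p % 4 = 3 →
        (∃ C : VariableChange ℚ, C • V.quadraticTwist (-(p : ℚ)) = W) →
        Mult V p →
        κ.IsCyclotomic → κ.IsTopGenerator γ → IsCyclotomicVariable p γ → IsNewformOf V f →
        ∀ (ap : ℤ), cuspCoeff f p = ap →
        ∀ (D : W.SelmerDualData κ γ) (ϖ : ℚ), (ϖ : ℝ) * V.imaginaryPeriodRat = minusPeriod f →
          ∀ g ∈ D.charIdeal, ∃ (G : IwasawaAlgebra p) (m n : ℕ),
            PowerSeries.C ((p : ℤ_[p]) ^ m) * g ∈ Ideal.span {G} ∧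
            iwasawaToPowerSeries p G =
              PowerSeries.C ((p : ℚ_[p]) ^ n) *
                (PowerSeries.C (ϖ : ℚ_[p]) * padicLFunctionMinusBranchMult f (ap : ℚ_[p]) (p / 2)) :=
  Iff.rfl

/-- **The rational EQUALITY implies the one-sided rational containment** (trivial direction).
[cite: SkinnerUrban2014, Thm. 3.6.4 (p. 43) (shape only)] -/
theorem chiBranchRatLowerDvdMultOddAt_of_ratCharEqMultOdd (W : WeierstrassCurve ℚ) (p : ℕ)
    [hp : Fact p.Prime] (h : ChiBranchRatCharEqMultOddAt W p) : ChiBranchRatLowerDvdMultOddAt W p := by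
  intro V _ _ κ γ N _ f hp3 hCW hV hκ hγ hcv hf ap hap D ϖ hϖ g hg
  obtain ⟨-, g₀, k, hchar, hι⟩ := h V hp3 hCW hV hκ hγ hcv hf ap hap D ϖ hϖ
  have hp0 : (p : ℚ_[p]) ≠ 0 := Nat.cast_ne_zero.mpr hp.out.ne_zero
  rw [hchar] at hg
  obtain ⟨s, rfl⟩ := Ideal.mem_span_singleton'.mp hg
  rcases le_or_gt 0 k with hk | hk
  · obtain ⟨n, rfl⟩ : ∃ n : ℕ, k = n := ⟨k.toNat, (Int.toNat_of_nonneg hk).symm⟩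
    refine ⟨g₀, 0, n, ?_, ?_⟩
    · rw [pow_zero, map_one, one_mul]
      exact Ideal.mem_span_singleton'.mpr ⟨s, rfl⟩
    · rw [hι, zpow_natCast, map_mul, mul_assoc]
  · obtain ⟨m, hm⟩ : ∃ m : ℕ, -k = m := ⟨(-k).toNat, (Int.toNat_of_nonneg (by omega)).symm⟩
    refine ⟨PowerSeries.C ((p : ℤ_[p]) ^ m) * g₀, m, 0, ?_, ?_⟩
    · exact Ideal.mem_span_singleton'.mpr ⟨s, by ring⟩
    · rw [map_mul, hι, iwasawaToPowerSeries_C_natCast_pow, pow_zero, map_one, one_mul, ← mul_assoc,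
        ← map_mul, ← mul_assoc, ← zpow_natCast, ← hm, ← zpow_add₀ hp0, neg_add_cancel, zpow_zero,
        one_mul]

/-! ### §1 Kato's half on `X(E/ℚ_∞)` for the multiplicative twist — the full series -/

section Core

variable {p : ℕ} [hp : Fact p.Prime]

/-- **additive-p1's half-tail core, keeping the SERIES** (`SelmerDualData.isTorsion_and_exists_constantCoeff_of_halfTail`
before `T = 0`): for `p` odd, `c = p*` a non-square, a twist model `C • V^{(c)} = W`, `κ` cyclotomic
with generator `γ` matching the cyclotomic variable, `D : W.SelmerDualData κ γ`, and the `F`-level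
componentwise input for `V` and a series `B` (for every quadratic `K ∋ √c`, every `F = ℚ(ζ_p)`, every
normalised generator and every eigen datum: torsion and some `g ∈ char` with `ι g = u·ϖ·B`): `X(W/ℚ_∞)`
is torsion and some `g ∈ char_Λ X(W/ℚ_∞)` has `ι g = u·ϖ·B`. Route as there. [folklore] -/
theorem isTorsion_and_exists_map_eq_of_halfTail
    {V W : WeierstrassCurve ℚ} [V.IsElliptic] [V.IsGloballyMinimal] {c : ℚ}
    [(V.quadraticTwist c).IsElliptic] [W.IsElliptic] {C : VariableChange ℚ}
    (hCW : C • V.quadraticTwist c = W) (hp2 : p ≠ 2) (hc : ∀ r : ℚ, r ^ 2 ≠ c)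
    (hcp : ((-1 : ℚ) ^ (p / 2) * p) = c)
    {κ : ZpExtension ℚ p} (hκ : κ.IsCyclotomic) {γ : Field.absoluteGaloisGroup ℚ}
    (hγ : κ.IsTopGenerator γ) (hcyc : IsCyclotomicVariable p γ) (D : W.SelmerDualData κ γ)
    {B : PowerSeries ℚ_[p]} {ϖ : ℚ}
    (htail : ∀ (K : Type) [Field K] [NumberField K] [(galRange (K := ℚ) K).Normal]
      (F : Type) [Field F] [NumberField F] [IsCyclotomicExtension {p} ℚ F]
      [(galRange (K := ℚ) F).Normal] {γ' : Field.absoluteGaloisGroup ℚ},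
      Module.finrank ℚ K = 2 → (∃ θ : K, θ ^ 2 = algebraMap ℚ K ((-1) ^ (p / 2) * p)) →
      κ.IsTopGenerator γ' → IsCyclotomicVariable p γ' →
      γ' ∈ galRange (K := ℚ) K → γ' ∈ galRange (K := ℚ) F →
      ∀ (D' : V.EigenSelmerDualData p
          (κ.kerSubgroup ⊓ galRange (K := ℚ) K ⊓ galRange (K := ℚ) F) κ.kerSubgroup
          (fun g ↦ if g ∈ galRange (K := ℚ) K then 1 else -1) γ'),
        Module.IsTorsion (IwasawaAlgebra p) D'.X ∧
        ∃ g ∈ D'.charIdeal, ∃ u : ℤ_[p]ˣ,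
          iwasawaToPowerSeries p g = PowerSeries.C (((u : ℤ_[p]) : ℚ_[p]) * (ϖ : ℚ_[p])) * B) :
    D.IsTorsion ∧ ∃ g ∈ D.charIdeal, ∃ u : ℤ_[p]ˣ,
      iwasawaToPowerSeries p g = PowerSeries.C (((u : ℤ_[p]) : ℚ_[p]) * (ϖ : ℚ_[p])) * B := by
  -- the fields
  obtain ⟨K, _, _, h2, θ, hθ, hθ2⟩ := exists_quadraticField_sq_eq hc
  haveI : IsGalois ℚ K := isGalois_of_finrank_eq_two K h2
  haveI : (galRange (K := ℚ) K).Normal := RelModel.normal_galRange (K := ℚ) K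
  obtain ⟨F, _, _, _⟩ := exists_isCyclotomicExtension p
  haveI : (galRange (K := ℚ) F).Normal := normal_galRange_cyclotomic p F
  -- the `F`-level eigen datum with the same characteristic ideal
  obtain ⟨γ', hγ'KF, hκγ', ⟨g₀, hg₀, hγ'eq⟩, D', hchar, htor⟩ :=
    SelmerDualData.exists_chiEigenInCyclotomic p F V K h2 hθ hθ2 κ hCW hp2 D
  have hγ'top : κ.IsTopGenerator γ' := isTopGenerator_of_kappa_eq κ hκγ' hγ
  have hγ'cyc : IsCyclotomicVariable p γ' :=
    isCyclotomicVariable_of_eq_mul (p := p) (κ := κ) hκ hg₀ hγ'eq hcyc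
  obtain ⟨htor', g, hg, u, hu⟩ := htail K F h2 ⟨θ, by rw [hcp]; exact hθ2⟩ hγ'top hγ'cyc
    (Subgroup.mem_inf.mp hγ'KF).1 (Subgroup.mem_inf.mp hγ'KF).2
    (ChiEigenSelmerInDualData.toEigen V K κ _ γ' D')
  refine ⟨htor.mp htor', g, ?_, u, hu⟩
  rw [← hchar]
  exact hg

end Core

section KatoHalf

variable (W : WeierstrassCurve ℚ) [W.IsElliptic] (p : ℕ) [hp : Fact p.Prime]

/-- **Kato's half of the odd-branch main conjecture of the MULTIPLICATIVE twist, on `X(E/ℚ_∞)`, as a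
power series identity.** For `W/ℚ` potentially multiplicative at `p ≡ 3 (mod 4)` (`PotMult W p`), every
globally minimal `V` with `C • V^{(−p)} = W` (then `V` is multiplicative at `p`,
`PotMult.mult_of_twist_model_pStar`), `ρ_{V,p^∞}` onto at every level, newform `f` with `a_p(f) = ap`,
cyclotomic `κ/γ`, `Λ`-dual datum `D` of `Sel_{p^∞}(W/ℚ_∞)` and `ϖ·|Ω⁻(V)| = Ω⁻_f`: `X(W/ℚ_∞)` is
`Λ`-torsion and some `g ∈ char_Λ X(W/ℚ_∞)` has `ι g = u · ϖ · L_p⁻(f, ap, ω^{(p−1)/2}, T)`, `u ∈ ℤ_pˣ`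
(the multiplicative disjuncts of `hKato`: `ap = 1` split, `ap = −1` non-split).
[cite: Kato2004Asterisque, Thm. 17.4 (3) (p. 273)] [cite: Wuthrich2014, Thm. 3 (p. 383), Cor. 19 (p. 398)]
[cite: GreenbergLNM1716, §5 p. 143] [cite: MazurTateTeitelbaum1986Invent, §I.10, §I.13] -/
theorem exists_mem_charIdeal_map_eq_unit_mul_minusBranchMult_of_katoHalf
    (hKato : Wuthrich2014.kato_halfEigenCharIdeal_dvd_cyclotomicPrime_of_surjective)
    (hpm : AdditivePotMult.PotMult W p)
    (V : WeierstrassCurve ℚ) [V.IsElliptic] [V.IsGloballyMinimal]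
    {κ : ZpExtension ℚ p} {γ : Field.absoluteGaloisGroup ℚ} {N : ℕ} [NeZero N]
    {f : CuspForm (Gamma0 N) 2} (hp3 : p % 4 = 3)
    (hCW : ∃ C : VariableChange ℚ, C • V.quadraticTwist (-(p : ℚ)) = W)
    (hsurj : ∀ n : ℕ, V.HasSurjectiveModNGaloisRep (p ^ n : ℕ))
    (hκ : κ.IsCyclotomic) (hγ : κ.IsTopGenerator γ) (hcv : IsCyclotomicVariable p γ)
    (hf : IsNewformOf V f) {ap : ℤ} (hap : cuspCoeff f p = ap) (D : W.SelmerDualData κ γ) (ϖ : ℚ)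
    (hϖ : (ϖ : ℝ) * V.imaginaryPeriodRat = minusPeriod f) :
    D.IsTorsion ∧ ∃ g ∈ D.charIdeal, ∃ u : ℤ_[p]ˣ,
      iwasawaToPowerSeries p g =
        PowerSeries.C (((u : ℤ_[p]) : ℚ_[p]) * (ϖ : ℚ_[p])) *
          padicLFunctionMinusBranchMult f (ap : ℚ_[p]) (p / 2) := by
  obtain ⟨C, hCW'⟩ := hCW
  have hp2 : p ≠ 2 := by rintro rfl; norm_num at hp3
  obtain ⟨hodd, hps⟩ := not_even_half_of_mod_four_eq_three hp3
  have hpQ : (-(p : ℚ)) ≠ 0 := neg_ne_zero.mpr (Nat.cast_ne_zero.mpr hp.out.ne_zero)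
  haveI : (V.quadraticTwist (-(p : ℚ))).IsElliptic := isElliptic_quadraticTwist V hpQ
  have hV : Mult V p := hpm.mult_of_twist_model_pStar hp2 V C (by rw [hps]; exact hCW')
  -- the disjunct of the fact: split (`ap = 1`) or non-split (`ap = −1`)
  have hdisj : (IsOrdinaryAt V p ∧
        padicLFunctionMinusBranchMult f (ap : ℚ_[p]) (p / 2) =
          if Even (p / 2) then padicLFunctionBranch f ((unitRoot V p : ℤ_[p]) : ℚ_[p]) (p / 2)
          else padicLFunctionMinusBranch f ((unitRoot V p : ℤ_[p]) : ℚ_[p]) (p / 2)) ∨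
      (V.HasSplitMultiplicativeReductionAtPrime p ∧
        padicLFunctionMinusBranchMult f (ap : ℚ_[p]) (p / 2) =
          if Even (p / 2) then padicLFunctionPlusBranchMult f (1 : ℚ_[p]) (p / 2)
          else padicLFunctionMinusBranchMult f (1 : ℚ_[p]) (p / 2)) ∨
      (V.HasMultiplicativeReductionAtPrime p ∧ ¬ V.HasSplitMultiplicativeReductionAtPrime p ∧
        padicLFunctionMinusBranchMult f (ap : ℚ_[p]) (p / 2) =
          if Even (p / 2) then padicLFunctionPlusBranchMult f (-1 : ℚ_[p]) (p / 2)
          else padicLFunctionMinusBranchMult f (-1 : ℚ_[p]) (p / 2)) := by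
    by_cases hs : V.HasSplitMultiplicativeReductionAtPrime p
    · obtain ⟨h1, -⟩ := hf.cuspCoeff_eq_one_and_sq_of_split hs
      obtain rfl : ap = 1 := by exact_mod_cast (hap.symm.trans h1 : ((ap : ℤ) : ℂ) = 1)
      refine Or.inr (Or.inl ⟨hs, ?_⟩)
      rw [if_neg hodd, Int.cast_one]
    · obtain ⟨h1, -⟩ := hf.cuspCoeff_eq_neg_one_and_dvd_of_nonsplit hV hs
      obtain rfl : ap = -1 := by exact_mod_cast (hap.symm.trans h1 : ((ap : ℤ) : ℂ) = -1)
      refine Or.inr (Or.inr ⟨hV, hs, ?_⟩)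
      rw [if_neg hodd, Int.cast_neg, Int.cast_one]
  refine isTorsion_and_exists_map_eq_of_halfTail hCW' hp2
    (fun r hr ↦ not_sq_eq_pStar p r (by rw [hps]; exact hr)) hps hκ hγ hcv D ?_
  intro K _ _ _ F _ _ _ _ γ' h2 hθ hγ' hcyc' hγ'K hγ'F D'
  exact hKato p V K F (padicLFunctionMinusBranchMult f (ap : ℚ_[p]) (p / 2)) hp2 h2 hθ hdisj hsurj hκ
    hγ' hcyc' hγ'K hγ'F hf D' ϖ (by rw [if_neg hodd]; exact hϖ)

end KatoHalf

/-! ### §2 The split: Kato's half + the typed one-sided containment = `ChiBranchRatCharEqMultOddAt` -/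

section Split

variable {W : WeierstrassCurve ℚ} [W.IsElliptic] {p : ℕ} [hp : Fact p.Prime]

/-- **Kato's printed half + the typed RATIONAL one-sided containment ⟹ the rational odd-branch main
conjecture of the multiplicative twist, `ChiBranchRatCharEqMultOddAt W p`** — for `W` potentially
multiplicative at `p` with `ρ̄_{W,p^n}` onto for all `n` (transported to `V` by
`GaloisImage.hasSurjectiveModNGaloisRep_pow_iff_of_model_twist`); the two divisibilities in `Λ ⊗ ℚ_p`
give a generator `g'` with `ι g' = p^k ϖ L_p⁻` (`exists_span_eq_and_map_eq_C_zpow_mul`, the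
bookkeeping of SU Thm. 3.6.4, p. 43). [cite: SkinnerUrban2014, Thm. 3.6.4, proof (p. 43)]
[cite: Kato2004Asterisque, Thm. 17.4 (3) (p. 273)] -/
theorem chiBranchRatCharEqMultOddAt_of_katoHalf_of_ratLowerDvd
    (hKato : Wuthrich2014.kato_halfEigenCharIdeal_dvd_cyclotomicPrime_of_surjective)
    (hpm : AdditivePotMult.PotMult W p) (htower : ∀ n : ℕ, W.HasSurjectiveModNGaloisRep (p ^ n : ℕ))
    (hE : ChiBranchRatLowerDvdMultOddAt W p) : ChiBranchRatCharEqMultOddAt W p := by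
  intro V _ _ κ γ N _ f hp3 hCW hV hκ hγ hcv hf ap hap D ϖ hϖ
  have hpne : (-(p : ℚ)) ≠ 0 := neg_ne_zero.mpr (Nat.cast_ne_zero.mpr hp.out.ne_zero)
  have hsurjV : ∀ n : ℕ, V.HasSurjectiveModNGaloisRep (p ^ n : ℕ) := fun n ↦
    (GaloisImage.hasSurjectiveModNGaloisRep_pow_iff_of_model_twist V p hpne hCW n).mp (htower n)
  obtain ⟨htor, g₁, hg₁, u, hιg₁⟩ :=
    exists_mem_charIdeal_map_eq_unit_mul_minusBranchMult_of_katoHalf W p hKato hpm V hp3 hCW hsurjV hκ hγ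
      hcv hf hap D ϖ hϖ
  obtain ⟨g, hchar, -⟩ := exists_charIdeal_eq_span_singleton p D
  obtain ⟨G, m, n, hG, hιG⟩ := hE V hp3 hCW hV hκ hγ hcv hf ap hap D ϖ hϖ g
    (by rw [hchar]; exact Ideal.mem_span_singleton_self g)
  have hg₁' : PowerSeries.C ((u⁻¹ : ℤ_[p]ˣ) : ℤ_[p]) * g₁ ∈ Ideal.span {g} := by
    rw [← hchar]; exact Ideal.mul_mem_left _ _ hg₁
  have hCu : iwasawaToPowerSeries p (PowerSeries.C ((u⁻¹ : ℤ_[p]ˣ) : ℤ_[p])) =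
      PowerSeries.C ((((u⁻¹ : ℤ_[p]ˣ) : ℤ_[p]) : ℚ_[p])) := by
    rw [PowerSeries.map_C, PadicInt.algebraMap_apply]
  have hu0 : (((u : ℤ_[p]) : ℚ_[p])) ≠ 0 := by
    intro h0
    have h1 : (((u⁻¹ : ℤ_[p]ˣ) : ℤ_[p]) : ℚ_[p]) * (((u : ℤ_[p]) : ℚ_[p])) = 1 := by
      rw [← PadicInt.coe_mul, Units.inv_mul, PadicInt.coe_one]
    rw [h0, mul_zero] at h1
    exact zero_ne_one h1
  have hιg₁' : iwasawaToPowerSeries p (PowerSeries.C ((u⁻¹ : ℤ_[p]ˣ) : ℤ_[p]) * g₁) =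
      PowerSeries.C ((p : ℚ_[p]) ^ (0 : ℕ)) *
        (PowerSeries.C (ϖ : ℚ_[p]) * padicLFunctionMinusBranchMult f (ap : ℚ_[p]) (p / 2)) := by
    rw [pow_zero, map_one, one_mul, map_mul, hιg₁, hCu, ← mul_assoc, ← map_mul, coe_units_inv_eq_inv,
      ← mul_assoc, inv_mul_cancel₀ hu0, one_mul]
  obtain ⟨g', k, hspan, hιg'⟩ := exists_span_eq_and_map_eq_C_zpow_mul p hg₁' hιg₁' hG hιG
  refine ⟨htor, g', k, hchar.trans hspan, ?_⟩
  rw [hιg', map_mul, mul_assoc]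

/-- **X4(M) ∧ surj(p), `p ≡ 3 (mod 4)` (`p = 3` included): the rational odd-branch main conjecture of
the multiplicative twist from its Skinner half** — tower from surj(p) with NO certificate on (M)
(n1011-p14 `ClassX4M.towerSurj_of_surj`, every odd `p`; at `p = 3` through Wuthrich's Lemma 20 PROVED
in the tree). [cite: Kato2004Asterisque, Thm. 17.4 (3) (p. 273)] [cite: Wuthrich2014, Lemma 20 (p. 399)]
[cite: SkinnerUrban2014, Thm. 3.6.4, proof (p. 43)] -/
theorem _root_.Summit.BirchSwinnertonDyer.Rank1Residual.AdditivePotMult.ClassX4M.chiBranchRatCharEqMultOddAt_of_ratLowerDvd_of_surj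
    (hKato : Wuthrich2014.kato_halfEigenCharIdeal_dvd_cyclotomicPrime_of_surjective)
    (hX : AdditivePotMult.ClassX4M W p) (hsurj : Surj W p) (hE : ChiBranchRatLowerDvdMultOddAt W p) :
    ChiBranchRatCharEqMultOddAt W p :=
  chiBranchRatCharEqMultOddAt_of_katoHalf_of_ratLowerDvd hKato hX.potMult (hX.towerSurj_of_surj hsurj) hE

end Split

/-! ### §3 X4(M) ∧ surj(p): ends over `ChiBranchRatLowerDvdMultOddAt W p` + ONE unit coefficient -/

section Ends

variable {W : WeierstrassCurve ℚ} [W.IsElliptic] [W.IsGloballyMinimal] {p : ℕ} [hp : Fact p.Prime]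

/-- **X4(M) ∧ surj(p), `r_an = 0`, `p ≡ 3 (mod 4)` (`p = 3` included): the LOWER half
`ord_p #Ш_an ≤ ord_p #Ш` ⟸ the one-sided rational containment on the odd branch of the multiplicative
twist (`ChiBranchRatLowerDvdMultOddAt W p`) + ONE unit coefficient (`MultOddBranchUnitCoeffCert`)** (+ Kato's
half `hKato`, Delbourgo 1998 Prop. 4 exact (M) `hDelX`, GZK, modularity; p251062's
`ClassX4M.missingLowerBoundAt_rankZero_of_ratCharEqMultOdd_of_unitCoeff`). X4(M) stays CONSTRUCTION-SHAPED.
[cite: SkinnerUrban2014, Cor. 3.6.2 (p. 42) (shape only)] [cite: Kato2004Asterisque, Thm. 17.4 (3) (p. 273)]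
[cite: Delbourgo1998, Prop. 4 (p. 144), §2.2 Lemma (ii) (p. 139)] [cite: Miller2011LMS, Def. 1.1] -/
theorem _root_.Summit.BirchSwinnertonDyer.Rank1Residual.AdditivePotMult.ClassX4M.missingLowerBoundAt_rankZero_of_ratLowerDvdMultOdd_of_unitCoeff_of_surj
    (hKato : Wuthrich2014.kato_halfEigenCharIdeal_dvd_cyclotomicPrime_of_surjective)
    (hDelX : Delbourgo1998.prop4_rankZero_constantCoeff_eq_unit_mul_of_potMult)
    (hGZK : rank_eq_analyticRank_of_analyticRank_le_one) (hmod : hasEntireLFunction_rat)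
    (hmodD : nonempty_modularParametrizationData)
    (hX : AdditivePotMult.ClassX4M W p) (hp4 : p % 4 = 3) (hr : W.analyticRank = 0) (hsurj : Surj W p)
    (hE : ChiBranchRatLowerDvdMultOddAt W p) (hcert : MultOddBranchUnitCoeffCert W p) :
    MissingLowerBoundAt W p :=
  hX.missingLowerBoundAt_rankZero_of_ratCharEqMultOdd_of_unitCoeff hDelX hGZK hmod hmodD hp4 hr
    (hX.chiBranchRatCharEqMultOddAt_of_ratLowerDvd_of_surj hKato hsurj hE) hcert

/-- **X4(M) ∧ surj(p), `r_an = 0`, `p ≡ 3 (mod 4)`: `BSD(E,p)` ⟸ the ONE-SIDED rational containment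
on the odd branch of the multiplicative twist (`ChiBranchRatLowerDvdMultOddAt W p`, typed — the located
gap in its native `Λ ⊗ ℚ_p` currency) + ONE unit coefficient, and NOTHING ELSE typed**: Kato's half
`hKato` serves both the upgrade (§2) and the UPPER half (additive-p1's `ClassX4M.bsdp_rankZero_of_surj_of_lower`
inside p251062; its `hL20` binder is discharged by the tree's PROOF of Wuthrich's Lemma 20).
Nothing booked; X4(M) stays CONSTRUCTION-SHAPED. [cite: SkinnerUrban2014, Cor. 3.6.2 (p. 42) (shape only)]
[cite: Kato2004Asterisque, Thm. 17.4 (3) (p. 273)] [cite: Delbourgo1998, Prop. 4 (p. 144)]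
[cite: Wuthrich2014, Lemma 20 (p. 399)] [cite: Miller2011LMS, §1 and Def. 1.1] -/
theorem _root_.Summit.BirchSwinnertonDyer.Rank1Residual.AdditivePotMult.ClassX4M.bsdp_rankZero_of_ratLowerDvdMultOdd_of_unitCoeff_of_surj
    (hKato : Wuthrich2014.kato_halfEigenCharIdeal_dvd_cyclotomicPrime_of_surjective)
    (hDelX : Delbourgo1998.prop4_rankZero_constantCoeff_eq_unit_mul_of_potMult)
    (hDel : Delbourgo1998.prop4_rankZero_pow_dvd_constantCoeff)
    (hGZK : rank_eq_analyticRank_of_analyticRank_le_one) (hmod : hasEntireLFunction_rat)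
    (hmodD : nonempty_modularParametrizationData)
    (hX : AdditivePotMult.ClassX4M W p) (hp4 : p % 4 = 3) (hr : W.analyticRank = 0) (hsurj : Surj W p)
    (hE : ChiBranchRatLowerDvdMultOddAt W p) (hcert : MultOddBranchUnitCoeffCert W p) : BSDp W p :=
  hX.bsdp_rankZero_of_ratCharEqMultOdd_of_unitCoeff_of_surj hDelX hDel hGZK hmod hmodD
    Wuthrich2014.lemma20_surjective_threeAdic_of_semistable_holds hKato hp4 hr hsurj
    (hX.chiBranchRatCharEqMultOddAt_of_ratLowerDvd_of_surj hKato hsurj hE) hcert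

/-- **X4(M) ∧ surj(3), `r_an = 0`, at `p = 3` (the (M)@3 share of N11): `BSD(E,3)` ⟸
`ChiBranchRatLowerDvdMultOddAt W 3` + ONE unit coefficient, TOWER-FREE** — the `p = 3` minus-eigen
reading `hKato3` of p251062's end is DERIVED from the general half `hKato`
(`kato_minusEigenCharIdeal_dvd_cyclotomicThree_of_surjective_of_half`), so ONE Kato binder serves the
upgrade and the upper half. Nothing booked. [cite: SkinnerUrban2014, Cor. 3.6.2 (p. 42) (shape only)]
[cite: Kato2004Asterisque, Thm. 17.4 (3) (p. 273)] [cite: Delbourgo1998, Prop. 4 (p. 144)]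
[cite: Miller2011LMS, §1 and Def. 1.1] -/
theorem _root_.Summit.BirchSwinnertonDyer.Rank1Residual.AdditivePotMult.ClassX4M.bsdp_three_rankZero_of_ratLowerDvdMultOdd_of_unitCoeff_of_surj
    (hKato : Wuthrich2014.kato_halfEigenCharIdeal_dvd_cyclotomicPrime_of_surjective)
    (hDelX : Delbourgo1998.prop4_rankZero_constantCoeff_eq_unit_mul_of_potMult)
    (hDel : Delbourgo1998.prop4_rankZero_pow_dvd_constantCoeff)
    (hGZK : rank_eq_analyticRank_of_analyticRank_le_one) (hmod : hasEntireLFunction_rat)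
    (hmodD : nonempty_modularParametrizationData)
    (hX : AdditivePotMult.ClassX4M W 3) (hr : W.analyticRank = 0) (hsurj : Surj W 3)
    (hE : ChiBranchRatLowerDvdMultOddAt W 3) (hcert : MultOddBranchUnitCoeffCert W 3) : BSDp W 3 :=
  haveI : Fact (Nat.Prime 3) := ⟨Nat.prime_three⟩
  hX.bsdp_three_rankZero_of_ratCharEqMultOdd_of_unitCoeff_of_surj hDelX hDel hGZK hmod hmodD
    (kato_minusEigenCharIdeal_dvd_cyclotomicThree_of_surjective_of_half hKato) hr hsurj
    (hX.chiBranchRatCharEqMultOddAt_of_ratLowerDvd_of_surj hKato hsurj hE) hcert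

end Ends

end Summit.BirchSwinnertonDyer.Rank1Residual.Additive

end
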